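import Summits.PneNP.PneNP.Theorems.ConvexRankGatesConvexGateBlindXorDefs
import Summits.PneNP.PneNP.Theorems.ConvexRankGatesConvexGateBlindExactLiftingAnchored

/-!
# The classification of `stub_exactLifting`, stated for the line's own declarations

`ConvexRankGatesConvexGateBlindExactLiftingStrictRank.lean` (p93640) and `…ExactLiftingAnchored.lean` (p94029)
classify the open stub of line `xor-door-perfect-completeness` (crux `ConvexGateBlind`, stmt-PneNP-10680) using
VERBATIM COPIES (namespace `…Theorems.XorDoor.StrictRank`) of the line vocabulary, written before the line's own
vocabulary file `ConvexRankGatesConvexGateBlindXorDefs.lean` (namespace `…Theorems.XorDoor`, p94663) had landed.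
The two copies are definitionally equal; this file records the identifications (`Iff.rfl`) and restates the two
results for the line's declarations, so that they apply literally to the registered stub
`stub_exactLifting : Summit.PneNP.PneNP.Theorems.XorDoor.ExactLifting`:

* `xorDoor_exactLifting_rank_gap` — `ExactLifting → PerfectCompleteness →` an explicit family of positive integer
  matrices with `rk₊ ≤ #F·t³` and anchored/strict rank `≥ t^K - 1` for every `K` (Hrubeš 2020, Open Problem 4);
* `xorDoor_exactLifting_iff_anchored` (registered sub-goal) — `ExactLifting ↔ AnchoredLifting`, the ε-free form.
-/

set_option linter.dupNamespace false -- `Summit.PneNP.PneNP.…`: summit = sub-problem (D-0017)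

namespace Summit.PneNP.PneNP.Theorems.XorDoor

/-- The seat-3 copy of `Sat` is the line's `Sat`. [definitional] -/
theorem strictRank_sat_iff {n : ℕ} (y : Fin n → ZMod 2) (e : Pool n) : StrictRank.Sat y e ↔ Sat y e := Iff.rfl

/-- The seat-3 copy of `viol` is the line's `viol`. [definitional] -/
theorem strictRank_viol_eq {m : ℕ} (F : Finset (Pool m)) (y : Fin m → ZMod 2) :
    StrictRank.viol F y = viol F y := rfl

/-- The seat-3 copy of `HasConeFact` is the line's `HasConeFact`. [definitional] -/
theorem strictRank_hasConeFact_iff {α β : Type} (M : α → β → ℝ) (q r : ℕ) :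
    StrictRank.HasConeFact M q r ↔ HasConeFact M q r := Iff.rfl

/-- The seat-3 copy of `HasPerfectPseudoExp` is the line's. [definitional] -/
theorem strictRank_hasPerfectPseudoExp_iff {m : ℕ} (d : ℕ) (F : Finset (Pool m)) :
    StrictRank.HasPerfectPseudoExp d F ↔ HasPerfectPseudoExp d F := Iff.rfl

/-- The seat-3 copy of `PerfectCompleteness` is the line's stub statement `PerfectCompleteness`. [definitional] -/
theorem strictRank_perfectCompleteness_iff : StrictRank.PerfectCompleteness ↔ PerfectCompleteness := Iff.rfl

/-- The seat-3 copy of `ExactLifting` is the line's open stub statement `ExactLifting`. [definitional] -/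
theorem strictRank_exactLifting_iff : StrictRank.ExactLifting ↔ ExactLifting := Iff.rfl

/-- **`stub_exactLifting` ∧ `stub_perfectCompleteness` ⟹ Hrubeš 2020, Open Problem 4** (for the line's own
declarations). For every exponent `K` the two stubs produce an explicit 3-sparse system `F` and a threshold `T` such
that for all `t ≥ T` the positive integer matrix `lift_t(viol_F)` is a sum of `#F·t³` non-negative rank-one matrices,
yet every non-negative factorisation of it with an entrywise-positive rank-one term (in particular every strictly
positive one) has at least `t^K - 1` terms. [p93640, transported along `Iff.rfl`] -/
theorem xorDoor_exactLifting_rank_gap : ExactLifting → PerfectCompleteness → ∀ K : ℕ,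
    ∃ (m : ℕ) (F : Finset (Pool m)) (T : ℕ), ∀ t : ℕ, T ≤ t →
      HasConeFact (fun (x : Fin m → Fin t → ZMod 2) (w : Fin m → Fin t) =>
        (viol F (fun i => x i (w i)) : ℝ)) 0 (F.card * t ^ 3) ∧
      ∀ (r : ℕ) (a : (Fin m → Fin t → ZMod 2) → Fin (r + 1) → ℝ) (b : Fin (r + 1) → (Fin m → Fin t) → ℝ),
        (∀ x l, 0 ≤ a x l) → (∀ l w, 0 ≤ b l w) → (∀ x, 0 < a x 0) → (∀ w, 0 < b 0 w) →
        (∀ x w, (viol F (fun i => x i (w i)) : ℝ) = ∑ l, a x l * b l w) →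
        t ^ K ≤ r + 2 :=
  StrictRank.exactLifting_rank_gap

/-- **The ε-free form of the open stub, for the line's own declaration** (registered sub-goal):
`ExactLifting ↔ AnchoredLifting` — the stub is exactly a lower bound `t^{φ(d)} ≤ q + r + 1` on the ANCHORED
(one entrywise-positive rank-one term; in the LP part: strict, `rk₊₊`) cone factorisations of the UNSHIFTED
lift `lift_t(viol_F)`. [p94029, transported along `Iff.rfl`] -/
theorem xorDoor_exactLifting_iff_anchored : ExactLifting ↔ StrictRank.AnchoredLifting :=
  StrictRank.exactLifting_iff_anchored

end Summit.PneNP.PneNP.Theorems.XorDoor
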